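import Summits.BirchSwinnertonDyer.BirchSwinnertonDyer.Theses.GenusKolyvaginAtTwo
import Summits.BirchSwinnertonDyer.BirchSwinnertonDyer.Theorems.GenusKolyvaginAtTwoMinimalTwinBSDTwoStructure
import HarnessLib

/-!
# Crux `MinimalTwinBSDTwo` (stmt-BirchSwinnertonDyer-22985), line `gzkunit` — REDUCTION SKELETON v1
# (prover seat bsd-line-gk2-p2 g0, 2026-08-27; route `GenusKolyvaginAtTwo`, DRAFT rev 2)

Crux (verbatim): `∀ W [IsElliptic] [IsGloballyMinimal], ¬ W.HasCM → W.analyticRank = 1 → Nat.card (W.selmerGroup 2) = 2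
→ BSDp W 2` — BSD₂ for the `2`-Selmer-minimal rank-one twins the route's supply crux produces.

LINE `gzkunit` = { `stub_gzk` — PRINT (bsd.S17 Gross–Zagier–Kolyvagin, Darmon 2004 Thm. 3.22, the tree's named fact
`rank_eq_analyticRank_of_analyticRank_le_one`; closes when that fact is discharged — its leaves are modularity, the
Gross–Zagier formula, Kolyvagin's theorem and a non-vanishing twist, `LeadingTermProofs.rank_eq_analyticRank_of_analyticRank_le_one_of`),
`stub_shaAnUnit` — THE RESEARCH INPUT (U₂): on the crux's class, `#Ш_an(W)` is a rational `2`-adic unit, i.e. (given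
`Ш[2^∞] = 0`, `#W(ℚ)_tors` odd, both free here) `ord₂ (L'(W,1)/(Ω_W · Reg W)) = ord₂ ∏_p c_p(W)` — the `2`-part of the BSD
formula in analytic rank one for non-CM `2`-Selmer-minimal curves; NOT in print (p-part of BSD in rank one is printed for
odd `p` only: Jetchev–Skinner–Wan 2017, Castella 2018, Burungale–Skinner–Tian–Wan 2024 «p ≥ 3»; at `p = 2` only for explicit
twist families, Coates–Li–Tian–Zhai 2015 / Cai–Li–Zhai 2020) }.
KERNEL (landed, p579783 + append p581440, `Theorems/GenusKolyvaginAtTwoMinimalTwinBSDTwoStructure.lean`):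
`structure_of_card_selmerGroup_two` (GZK ⟹ rank `1`, `E(ℚ)[2] = 0`, `Ш[2] = 0`, `Ш[2^∞] = ⊥`, `BSDp W 2 ⟺ (U₂)(W)`),
`minimalTwinBSDTwo_of_gzk_of_unit` (the composition), `unit_of_gzk_of_minimalTwinBSDTwo` (the converse: granted GZK the
crux IS (U₂) — the reduction loses nothing) and `shaAnUnit_of_bsdTriple` (guard: BSD(`W`) ⟹ (U₂)(W), so the stub is not
an artefact and is refutable only with BSD itself). `MinimalTwinBSDTwo_of` below concludes the crux BY NAME; sorries only
in `stub_*`. BSD is not proved by any of this.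

PLACEMENT INSIDE THE LINE (for the planner-of-record). For the twins the glue actually consumes — `Wd ≅ E^{(d_K)}` with `E`
in the habitat (rank `0`) and `K` the route's Heegner field — the tree's pair theorem
`Summit.BirchSwinnertonDyer.Rank1Residual.P2.bsdp_iff_bsdp_twist_of_heegnerIndexOverK` (file
`Summits/BirchSwinnertonDyer/Rank1Residual/P2/HeegnerIndexAtTwoOverKDescent.lean`; binders: Gross–Zagier, Kolyvagin, GZK,
modularity, Milne 1972 — all named facts — plus the `K`-side valuation identity
`ord₂(4·[E(K):ℤP_K]²/(c²·w_K²·c(E_K))) = ord₂ #Ш(E_K/K)`, which is exactly what KolyvaginExactAtTwo (crux 22137) + the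
`2`-adic bookkeeping of ExactDescentAtTwo (crux 22138) deliver) gives `BSDp E 2 ↔ BSDp Wd 2` at `p = 2`. So ON THE
ROUTE'S OWN TWINS crux #6 is EQUIVALENT to the route's target `BSD₂(E)`: it cannot be produced inside the line (the
Theses' foreseen derivation «KolyvaginExactAtTwo at `M₀ = 0` for the twin's own Heegner field `K'`» only moves to the
pair `(Wd, Wd^{(d_{K'})})` and needs BSD₂ of THAT rank-`0` partner — a regress; Kriz–Li 2019 §5 p. 14: «Since the
Iwasawa main conjecture is not known for `p = 2`, the only known way to prove BSD(2) over ℚ is to compute the 2-part of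
both sides explicitly» for the rank-`0` member). An anchor EXTERNAL to the line is required for one member of each pair
(a rank-`0` BSD₂ engine at `2`: IMC transport / Kato-at-2 lines of the cell, or Zhai-type explicit `L(E,1)/Ω` formulas);
given such an anchor on the habitat, this line's genuine product is the TRANSFER `BSD₂(E) ⟹ BSD₂(E^{(d_K)})` — new
rank-ONE `2`-part results — rather than `BSD₂(E)` itself.

Foreseen attack on `stub_shaAnUnit` inside the route (Theses docstring, crux #6): KolyvaginExactAtTwo (crux 22137) at
`M₀ = 0` for the twin's own Heegner field `K'` (`Ш(W/K')[2^∞] = 0`) + `2`-primitivity of `y_{K'}` for Sel₂-minimal pairs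
(W. Zhang's theorem ported to `p = 2`) + rank-one Gross–Zagier bookkeeping at `2` (Manin constant, real components,
`[W(K') : W(ℚ) + W^{D}(ℚ)]`, Kramer 1981) — the last step needs BSD₂ of the rank-ZERO partner `W^{(d_{K'})}` or an
integrality statement for `#Ш_an` at `2`, which is where a second line would have to differ.
-/

set_option autoImplicit false
set_option linter.dupNamespace false -- `Summit.BirchSwinnertonDyer.BirchSwinnertonDyer.…` is the tree's layout (D-0017)

noncomputable section

open scoped Classical

namespace Summit.BirchSwinnertonDyer.BirchSwinnertonDyer.Cruxes.MinimalTwinBSDTwo.GzkUnit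

open WeierstrassCurve Literature.NumberTheory.EllipticCurves
  Summit.BirchSwinnertonDyer.BirchSwinnertonDyer.Theorems

/-! ## §1 The two stubs -/

/-- STUB `stub_gzk` — THE PUBLISHED INPUT BY NAME: bsd.S17, Gross–Zagier–Kolyvagin («if `ord_{s=1} L(E,s) ≤ 1` then
`rank E(ℚ) = ord_{s=1} L(E,s)` and `Ш(E/ℚ)` is finite», Darmon 2004 Thm. 3.22), the tree's named fact
`Literature.NumberTheory.EllipticCurves.rank_eq_analyticRank_of_analyticRank_le_one` (file `LeadingTerm`). Only its rank
clause at `r_an = 1` is consumed. Closes when the fact is discharged (`_holds`); size XL (its four leaves are themselves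
named facts). [cite: Darmon2004, Thm. 3.22 (= Thm. 1.14) and §3.9] -/
theorem stub_gzk : rank_eq_analyticRank_of_analyticRank_le_one := by
  sorry

/-- STUB `stub_shaAnUnit` — THE RESEARCH INPUT (U₂): for `W/ℚ` elliptic, globally minimal, non-CM, with `r_an(W) = 1` and
`#Sel₂(W) = 2`, and given (free, by the kernel theorem) `rank W(ℚ) = 1`, `#E(ℚ)[2] = 1`, `Ш(W/ℚ)[2^∞] = ⊥`: the analytic
order of `Ш`, `#Ш_an(W) = L'(W,1)·#W(ℚ)_tors² / (Ω_W · ∏_p c_p · Reg W)` (`shaAn W`, Miller 2011 §1), is a rational number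
of `2`-adic valuation `0`. Equivalently (granted GZK) the crux itself (`unit_of_gzk_of_minimalTwinBSDTwo`). OPEN — the
`2`-part of BSD in analytic rank one for a general non-CM curve is not in print. [cite: Miller2011LMS, Def. 1.1 and §1]
[cite: GrossZagier1986, Thm. I.(6.3) and V.(2.1)] -/
theorem stub_shaAnUnit :
    ∀ (W : WeierstrassCurve ℚ) [W.IsElliptic] [W.IsGloballyMinimal], ¬ W.HasCM → W.analyticRank = 1 →
      Nat.card (W.selmerGroup 2) = 2 → W.mordellWeilRank = 1 →
      Nat.card (AddSubgroup.torsionBy W.toAffine.Point (2 : ℤ)) = 1 →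
      AddCommGroup.primaryComponent W.sha 2 = ⊥ →
      ∃ r : ℚ, shaAn W = (r : ℂ) ∧ padicValRat 2 r = 0 := by
  sorry

/-! ## §2 The composition: the crux BY NAME from the two stubs -/

/-- **`MinimalTwinBSDTwo` from the line's stubs.** The kernel theorem
`Theorems.MinimalTwinBSDTwo.minimalTwinBSDTwo_of_gzk_of_unit` (p579783) concludes the crux BY NAME from `stub_gzk` and
`stub_shaAnUnit`. Sorry-free; the only sorries of the file are the two stubs. [folklore] -/
theorem MinimalTwinBSDTwo_of :
    Summit.BirchSwinnertonDyer.BirchSwinnertonDyer.Theses.GenusKolyvaginAtTwo.MinimalTwinBSDTwo :=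
  MinimalTwinBSDTwo.minimalTwinBSDTwo_of_gzk_of_unit stub_gzk stub_shaAnUnit

end Summit.BirchSwinnertonDyer.BirchSwinnertonDyer.Cruxes.MinimalTwinBSDTwo.GzkUnit

end
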